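import Summits.QuantumFields.BalabanUV.Beta.FP.SecondVarKernelLaw

/-!
# `BalabanUV.Beta.FP.DressedWordsPacked` — road «FP» for binder row D1, ROUTE T, THE LEVEL-0 ASSEMBLY, STEP 1 (memo `N2B-DESIGN.md` (31d) ∕ (32e),
# TID § F.10 (L1)), G-SIDE: **THE GRADED DOOR's TWO DRESSED COARSE WORDS PACK OVER DIRECTIONS** — the order-1 word is linear and the order-2 word,
# POLARISED, is a packed quadratic in the per-direction tables (OWNER #32)

WHY.  STEP 1 of the level-0 assembly (OWNER; memo (32e)) instantiates the (STEP) door of record (U21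
`NestedStepLawTorusTransportedRowsGradedLevelZeroSymULowClosedLamW2Q2`, and whichever U-file succeeds it) at a packed direction `h := Σ_k r_k • h_k`
(nested columns, #29 `NestedColumnCombDead`), `λ := Σ_k r_k • λ_k`, and must rewrite EVERY jet of the three graded systems as `Σ_k r_k • (·)_k` (order 1) ∕
`Σ_{k,l} (r_k·r_l) • (·)_{kl}` (order 2) to land on #20 `SecondVarKernelLaw.mixedVar_kernel_law_of_secondVar_law_graded`'s `hlaw` VERBATIM.  For the
one-shot (N) and fine (F) systems the jets are finite `Σ_b h b • T_b` ∕ `Σ_{b,b′} (h b·h b′) • T_{bb′}` families and #26 `PackedRepacking` does it.  For the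
COARSE (G) system the jets are the DRESSED WORDS of the nested chart (door p323821 `NestedStepLawOneShotJetsGraded`, VERBATIM in every torus call since):
order 1 `W₁(H₁, B) := (L·H₁ − S·B)·I + L·Bᵀ·S`, order 2 the long word `W₂(H₁, B, H₂, B_q)` in the fine first jets `H₁`, `B = [Q₁₁ h; 0]`, the fine second
jets `H₂`, `B_q = [Q₁₂ h h; 0]` and the direction-free structure `Γ I L S` (fluctuation covariance, minimiser, left companion, effective form).  This file is
the [folklore] multilinear bookkeeping that packs them:
* §1 `pack_pair_of_add_smul ∕ pack_pair₂_of_add_smul` — a map of a PAIR of arguments that is jointly additive and homogeneous packs finite weighted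
  families (`Φ (Σ r•a) (Σ r•b) = Σ_k r_k • Φ (a k) (b k)`); two such pair-slots ⇒ `Σ_k Σ_l (r_k·r_l) • …` (Finset induction; no `LinearMap` bureaucracy at
  the consumer); `fromRows_zero_sum_smul ∕ toBlocks₁₁_sum_smul` (+ double-sum twins) for the zero-slice borders and the `μμ` blocks;
* §2 ORDER 1: `orderOne_word_add ∕ orderOne_word_smul ∕ orderOne_word_sum_smul` — `W₁(Σ r•H₁ᵏ, Σ r•Bᵏ) = Σ_k r_k • W₁(H₁ᵏ, Bᵏ)`;
* §3 ORDER 2, POLARISED: the two-slot word `W₂♭(H₁,B | H₁′,B′ | H₂,B_q)` := the door's word with, in every product of two first-order atoms, the LEFT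
  atom read at `(H₁,B)` and the RIGHT at `(H₁′,B′)` — so `W₂♭(X | X | Y)` IS the door's word CHARACTER FOR CHARACTER (no identification lemma at the
  consumer); `orderTwo_word_split` (`W₂♭(X|X′|H₂,B_q) = W₂♭(X|X′|0,0) + ((L·H₂ − S·B_q)·I − L·B_qᵀ·S)`), `orderTwo_bil_add_left ∕ _smul_left ∕ _add_right ∕
  _smul_right`, `orderTwo_lin_add ∕ _smul ∕ _sum_sum_smul`, and **`orderTwo_word_sum_sum_smul`**:
  `W₂♭(Σr•H₁ᵏ, Σr•Bᵏ | Σr•H₁ˡ, Σr•Bˡ | ΣΣ r_k r_l•H₂ᵏˡ, ΣΣ r_k r_l•B_qᵏˡ) = Σ_k Σ_l (r_k·r_l) • W₂♭(H₁ᵏ,Bᵏ | H₁ˡ,Bˡ | H₂ᵏˡ, B_qᵏˡ)`;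
* §4 the `.toBlocks₁₁` corollaries — #20 §5's `G₁ k ∕ G₂ k l` currency (the consumer symmetrises `G₂` with #20 `sum_sum_smul_symmetrise` at no cost).
* §5 `sum_smul_mul_sum_smul ∕ commutator_sum_smul ∕ diagonal_sum_smul` — products of packed families pack, hence the one-shot (N) system's only
  bilinear WORD, U20∕U21's `hH′₂` commutator `L(h)·E_λ − E_λ·L(h)` of the Λ half of `H₁` with the gauge generator, packs over direction pairs.
The structure sorts are ARBITRARY finite types (`ν` fields, `π` = all multipliers; `π = μ ⊕ ρ` only in §4), so the lemmas serve the door of record at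
`j = 1` AND the composite calls (#21) at `j ≥ 2`; R-FP-58's `G` and R-FP-59's companion pair enter the door's slots ADDITIVELY and do not touch the words.
No `def`, no `def … : Prop`, nothing cited, 0 sorry; 0 estimates.  NOT HERE: any U21 binder, any table or weight, the `μμ`-block CLOSED FORMS (leaf-05's
`CoarseJetOrderOne∕TwoGraded(Comb)` — read AFTER packing, per `(k,l)`), anything of the dictionary.

HONEST DEPENDENCY (page 1, mandatory): continuum YM on T⁴ ⇐ BetaPertH ∧ nine spine estimates (0/9 proved); BetaPertH ⇐ (D1) ∧ (D4) ∧ CAP+tail;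
G-an2-4 gates asym, D1 and NE2/3/4.  HONEST FRAMING (cell contract, verbatim): «discharging `BetaPertH` makes Bałaban's UV stability UNCONDITIONAL —
a real constructive-QFT result; it is NOT the continuum limit and NOT the Clay problem.»  ABSOLUTE RULE (cell charter, verbatim): «No internally-minted
statement may enter as a cited fact. Every hypothesis is either kernel-proved in this package or a verbatim quotation of a PUBLISHED theorem with page
reference. The manuscript(s) under audit are NOT citable for their own disputed steps — they are the thing under adjudication; programme-internal
(2001/route/tribunal) claims are never citable.»  [folklore] finite (bi)linear algebra; nothing of Bałaban's asserted; 0 estimates; 0∕4 row-D1 binders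
(hW, hR, D1Tel, D1Rep); NOT (T-ID), NOT SDF, NOT D1, NOT BetaPertH, NOT continuum, NOT Clay.  Road «FP» OWNER, b2b-balaban-beta-d1-p3 gen 24, 2026-08-23.
No existing file touched.
-/

noncomputable section

open scoped BigOperators Matrix

namespace Summit.QuantumFields.BalabanUV.Beta.FP.DressedWordsPacked

open Matrix

/-! ## §1 Jointly additive and homogeneous maps of a pair pack finite weighted families -/

section Pack

variable {A₁ A₂ B₁ B₂ N σ : Type*} [AddCommGroup A₁] [Module ℝ A₁] [AddCommGroup A₂] [Module ℝ A₂]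
  [AddCommGroup B₁] [Module ℝ B₁] [AddCommGroup B₂] [Module ℝ B₂] [AddCommGroup N] [Module ℝ N] [Fintype σ]

/-- [folklore] **A MAP OF A PAIR, JOINTLY ADDITIVE AND HOMOGENEOUS, PACKS**: `Φ (Σ_k r_k • a k) (Σ_k r_k • b k) = Σ_k r_k • Φ (a k) (b k)`
(Finset induction; one-slot maps are the case where `Φ` ignores `b`). -/
theorem pack_pair_of_add_smul (Φ : A₁ → A₂ → N)
    (hadd : ∀ a a' b b', Φ (a + a') (b + b') = Φ a b + Φ a' b')
    (hsmul : ∀ (c : ℝ) a b, Φ (c • a) (c • b) = c • Φ a b)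
    (r : σ → ℝ) (a : σ → A₁) (b : σ → A₂) :
    Φ (∑ k, r k • a k) (∑ k, r k • b k) = ∑ k, r k • Φ (a k) (b k) := by
  classical
  have h0 : Φ 0 0 = 0 := by simpa using hsmul 0 0 0
  suffices h : ∀ s : Finset σ, Φ (∑ k ∈ s, r k • a k) (∑ k ∈ s, r k • b k) = ∑ k ∈ s, r k • Φ (a k) (b k) from h _
  intro s
  refine Finset.induction_on s (by simpa using h0) ?_
  intro k s hk ih
  rw [Finset.sum_insert hk, Finset.sum_insert hk, Finset.sum_insert hk, hadd, hsmul, ih]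

/-- [folklore] **TWO PAIR-SLOTS PACK TO A DOUBLE SUM**: if `Ψ (a₁, a₂ | b₁, b₂)` is jointly additive and homogeneous in `(a₁, a₂)` and in `(b₁, b₂)`, then
`Ψ (Σ r•a₁, Σ r•a₂ | Σ r•b₁, Σ r•b₂) = Σ_k Σ_l (r_k·r_l) • Ψ (a₁ k, a₂ k | b₁ l, b₂ l)`. -/
theorem pack_pair₂_of_add_smul (Ψ : A₁ → A₂ → B₁ → B₂ → N)
    (haddl : ∀ a₁ a₁' a₂ a₂' b₁ b₂, Ψ (a₁ + a₁') (a₂ + a₂') b₁ b₂ = Ψ a₁ a₂ b₁ b₂ + Ψ a₁' a₂' b₁ b₂)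
    (hsmull : ∀ (c : ℝ) a₁ a₂ b₁ b₂, Ψ (c • a₁) (c • a₂) b₁ b₂ = c • Ψ a₁ a₂ b₁ b₂)
    (haddr : ∀ a₁ a₂ b₁ b₁' b₂ b₂', Ψ a₁ a₂ (b₁ + b₁') (b₂ + b₂') = Ψ a₁ a₂ b₁ b₂ + Ψ a₁ a₂ b₁' b₂')
    (hsmulr : ∀ (c : ℝ) a₁ a₂ b₁ b₂, Ψ a₁ a₂ (c • b₁) (c • b₂) = c • Ψ a₁ a₂ b₁ b₂)
    (r : σ → ℝ) (a₁ : σ → A₁) (a₂ : σ → A₂) (b₁ : σ → B₁) (b₂ : σ → B₂) :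
    Ψ (∑ k, r k • a₁ k) (∑ k, r k • a₂ k) (∑ l, r l • b₁ l) (∑ l, r l • b₂ l)
      = ∑ k, ∑ l, (r k * r l) • Ψ (a₁ k) (a₂ k) (b₁ l) (b₂ l) := by
  rw [pack_pair_of_add_smul (fun x y => Ψ x y (∑ l, r l • b₁ l) (∑ l, r l • b₂ l))
    (fun a a' b b' => haddl a a' b b' _ _) (fun c a b => hsmull c a b _ _) r a₁ a₂]
  refine Finset.sum_congr rfl fun k _ => ?_
  rw [pack_pair_of_add_smul (Ψ (a₁ k) (a₂ k)) (haddr (a₁ k) (a₂ k)) (fun c b b' => hsmulr c (a₁ k) (a₂ k) b b') r b₁ b₂,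
    Finset.smul_sum]
  refine Finset.sum_congr rfl fun l _ => ?_
  rw [smul_smul]

end Pack

section Blocks

variable {ν μ ρ σ : Type*} [Fintype σ]

/-- [folklore] The zero-slice border family packs: `[Σ_k r_k • Q k; 0] = Σ_k r_k • [Q k; 0]`. -/
theorem fromRows_zero_sum_smul (r : σ → ℝ) (Q : σ → Matrix μ ν ℝ) :
    fromRows (∑ k, r k • Q k) (0 : Matrix ρ ν ℝ) = ∑ k, r k • fromRows (Q k) (0 : Matrix ρ ν ℝ) := by
  ext i j
  rcases i with i | i <;> simp [Matrix.sum_apply, Matrix.fromRows]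

/-- [folklore] Double-sum twin: `[Σ_{k,l} (r_k·r_l) • Q k l; 0] = Σ_{k,l} (r_k·r_l) • [Q k l; 0]`. -/
theorem fromRows_zero_sum_sum_smul (r : σ → ℝ) (Q : σ → σ → Matrix μ ν ℝ) :
    fromRows (∑ k, ∑ l, (r k * r l) • Q k l) (0 : Matrix ρ ν ℝ) = ∑ k, ∑ l, (r k * r l) • fromRows (Q k l) (0 : Matrix ρ ν ℝ) := by
  ext i j
  rcases i with i | i <;> simp [Matrix.sum_apply, Matrix.fromRows]

/-- [folklore] The `μμ` block is linear: `(Σ_k r_k • X k).toBlocks₁₁ = Σ_k r_k • (X k).toBlocks₁₁`. -/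
theorem toBlocks₁₁_sum_smul (r : σ → ℝ) (X : σ → Matrix (μ ⊕ ρ) (μ ⊕ ρ) ℝ) :
    (∑ k, r k • X k).toBlocks₁₁ = ∑ k, r k • (X k).toBlocks₁₁ := by
  ext a a'
  simp [Matrix.toBlocks₁₁, Matrix.sum_apply]

/-- [folklore] Double-sum twin: `(Σ_{k,l} (r_k·r_l) • X k l).toBlocks₁₁ = Σ_{k,l} (r_k·r_l) • (X k l).toBlocks₁₁`. -/
theorem toBlocks₁₁_sum_sum_smul (r : σ → ℝ) (X : σ → σ → Matrix (μ ⊕ ρ) (μ ⊕ ρ) ℝ) :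
    (∑ k, ∑ l, (r k * r l) • X k l).toBlocks₁₁ = ∑ k, ∑ l, (r k * r l) • (X k l).toBlocks₁₁ := by
  ext a a'
  simp [Matrix.toBlocks₁₁, Matrix.sum_apply]

end Blocks

/-! ## §2 The order-1 dressed word `W₁(H₁, B) = (L·H₁ − S·B)·I + L·Bᵀ·S` is linear in `(H₁, B)` -/

section OrderOne

variable {ν π σ : Type*} [Fintype ν] [Fintype π] [Fintype σ]
variable (I : Matrix ν π ℝ) (L : Matrix π ν ℝ) (S : Matrix π π ℝ)

/-- [folklore] The order-1 word is ADDITIVE in the pair `(H₁, B)`. -/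
theorem orderOne_word_add (H₁ H₁' : Matrix ν ν ℝ) (B B' : Matrix π ν ℝ) :
    (L * (H₁ + H₁') - S * (B + B')) * I + L * (B + B')ᵀ * S
      = ((L * H₁ - S * B) * I + L * Bᵀ * S) + ((L * H₁' - S * B') * I + L * B'ᵀ * S) := by
  simp only [Matrix.mul_add, Matrix.add_mul, Matrix.sub_mul, transpose_add]
  abel

/-- [folklore] The order-1 word is HOMOGENEOUS in the pair `(H₁, B)`. -/
theorem orderOne_word_smul (c : ℝ) (H₁ : Matrix ν ν ℝ) (B : Matrix π ν ℝ) :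
    (L * (c • H₁) - S * (c • B)) * I + L * (c • B)ᵀ * S = c • ((L * H₁ - S * B) * I + L * Bᵀ * S) := by
  simp only [Matrix.mul_smul, Matrix.smul_mul, Matrix.sub_mul, transpose_smul, smul_add, smul_sub]

/-- [folklore] **THE ORDER-1 DRESSED WORD PACKS**: along packed first jets `H₁ = Σ_k r_k • H₁ᵏ`, `B = Σ_k r_k • Bᵏ`,
`(L·H₁ − S·B)·I + L·Bᵀ·S = Σ_k r_k • ((L·H₁ᵏ − S·Bᵏ)·I + L·(Bᵏ)ᵀ·S)`. -/
theorem orderOne_word_sum_smul (r : σ → ℝ) (H₁ : σ → Matrix ν ν ℝ) (B : σ → Matrix π ν ℝ) :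
    (L * (∑ k, r k • H₁ k) - S * (∑ k, r k • B k)) * I + L * (∑ k, r k • B k)ᵀ * S
      = ∑ k, r k • ((L * H₁ k - S * B k) * I + L * (B k)ᵀ * S) :=
  pack_pair_of_add_smul (fun H B => (L * H - S * B) * I + L * Bᵀ * S) (orderOne_word_add I L S) (orderOne_word_smul I L S) r H₁ B

end OrderOne

/-! ## §3 The order-2 dressed word, polarised: `W₂♭(H₁,B | H₁′,B′ | H₂,B_q)` -/

section OrderTwo

variable {ν π σ : Type*} [Fintype ν] [Fintype π] [Fintype σ]
variable (Γ : Matrix ν ν ℝ) (I : Matrix ν π ℝ) (L : Matrix π ν ℝ) (S : Matrix π π ℝ)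
/-- [folklore] **SPLIT**: the polarised order-2 word `W₂♭(H₁,B | H₁′,B′ | H₂,B_q)` (the door's word with the LEFT atom of every product of two
first-order atoms read at `(H₁,B)` and the RIGHT at `(H₁′,B′)`; at `H₁′ = H₁`, `B′ = B` it IS the door's word character for character) is its BILINEAR part
(the word at `H₂ = 0`, `B_q = 0`) plus its LINEAR part `(L·H₂ − S·B_q)·I − L·B_qᵀ·S`. -/
theorem orderTwo_word_split (H₁ H₁' H₂ : Matrix ν ν ℝ) (B B' Bq : Matrix π ν ℝ) :
    (((-((L * H₁ - S * B) * Γ - L * Bᵀ * L) * H₁' + L * H₂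
          - (((L * H₁ - S * B) * I + L * Bᵀ * S) * B' + S * Bq)) * I
        + (L * H₁ - S * B) * (-((Γ * H₁' + I * B') * I + Γ * B'ᵀ * S)))
      - ((-((L * H₁ - S * B) * Γ - L * Bᵀ * L) * (-B'ᵀ) + L * Bqᵀ) * S
          + L * (-Bᵀ) * ((L * H₁' - S * B') * I + L * B'ᵀ * S)))
      = (((-((L * H₁ - S * B) * Γ - L * Bᵀ * L) * H₁' + L * (0 : Matrix ν ν ℝ)
            - (((L * H₁ - S * B) * I + L * Bᵀ * S) * B' + S * (0 : Matrix π ν ℝ))) * I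
          + (L * H₁ - S * B) * (-((Γ * H₁' + I * B') * I + Γ * B'ᵀ * S)))
        - ((-((L * H₁ - S * B) * Γ - L * Bᵀ * L) * (-B'ᵀ) + L * (0 : Matrix π ν ℝ)ᵀ) * S
            + L * (-Bᵀ) * ((L * H₁' - S * B') * I + L * B'ᵀ * S)))
        + ((L * H₂ - S * Bq) * I - L * Bqᵀ * S) := by
  simp only [Matrix.mul_zero, transpose_zero, add_zero, Matrix.add_mul, Matrix.sub_mul]
  abel

/-- [folklore] The bilinear part is ADDITIVE in the LEFT pair `(H₁, B)`. -/
theorem orderTwo_bil_add_left (H₁ K₁ H₁' : Matrix ν ν ℝ) (B C B' : Matrix π ν ℝ) :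
    (((-((L * (H₁ + K₁) - S * (B + C)) * Γ - L * (B + C)ᵀ * L) * H₁' + L * (0 : Matrix ν ν ℝ)
          - (((L * (H₁ + K₁) - S * (B + C)) * I + L * (B + C)ᵀ * S) * B' + S * (0 : Matrix π ν ℝ))) * I
        + (L * (H₁ + K₁) - S * (B + C)) * (-((Γ * H₁' + I * B') * I + Γ * B'ᵀ * S)))
      - ((-((L * (H₁ + K₁) - S * (B + C)) * Γ - L * (B + C)ᵀ * L) * (-B'ᵀ) + L * (0 : Matrix π ν ℝ)ᵀ) * S
          + L * (-(B + C)ᵀ) * ((L * H₁' - S * B') * I + L * B'ᵀ * S)))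
      = (((-((L * H₁ - S * B) * Γ - L * Bᵀ * L) * H₁' + L * (0 : Matrix ν ν ℝ)
            - (((L * H₁ - S * B) * I + L * Bᵀ * S) * B' + S * (0 : Matrix π ν ℝ))) * I
          + (L * H₁ - S * B) * (-((Γ * H₁' + I * B') * I + Γ * B'ᵀ * S)))
        - ((-((L * H₁ - S * B) * Γ - L * Bᵀ * L) * (-B'ᵀ) + L * (0 : Matrix π ν ℝ)ᵀ) * S
            + L * (-Bᵀ) * ((L * H₁' - S * B') * I + L * B'ᵀ * S)))
        + (((-((L * K₁ - S * C) * Γ - L * Cᵀ * L) * H₁' + L * (0 : Matrix ν ν ℝ)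
              - (((L * K₁ - S * C) * I + L * Cᵀ * S) * B' + S * (0 : Matrix π ν ℝ))) * I
            + (L * K₁ - S * C) * (-((Γ * H₁' + I * B') * I + Γ * B'ᵀ * S)))
          - ((-((L * K₁ - S * C) * Γ - L * Cᵀ * L) * (-B'ᵀ) + L * (0 : Matrix π ν ℝ)ᵀ) * S
              + L * (-Cᵀ) * ((L * H₁' - S * B') * I + L * B'ᵀ * S))) := by
  simp only [Matrix.mul_zero, transpose_zero, add_zero, Matrix.mul_add, Matrix.add_mul, Matrix.sub_mul, Matrix.mul_sub,
    Matrix.neg_mul, Matrix.mul_neg, transpose_add, neg_add]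
  abel

/-- [folklore] The bilinear part is HOMOGENEOUS in the LEFT pair `(H₁, B)`. -/
theorem orderTwo_bil_smul_left (c : ℝ) (H₁ H₁' : Matrix ν ν ℝ) (B B' : Matrix π ν ℝ) :
    (((-((L * (c • H₁) - S * (c • B)) * Γ - L * (c • B)ᵀ * L) * H₁' + L * (0 : Matrix ν ν ℝ)
          - (((L * (c • H₁) - S * (c • B)) * I + L * (c • B)ᵀ * S) * B' + S * (0 : Matrix π ν ℝ))) * I
        + (L * (c • H₁) - S * (c • B)) * (-((Γ * H₁' + I * B') * I + Γ * B'ᵀ * S)))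
      - ((-((L * (c • H₁) - S * (c • B)) * Γ - L * (c • B)ᵀ * L) * (-B'ᵀ) + L * (0 : Matrix π ν ℝ)ᵀ) * S
          + L * (-(c • B)ᵀ) * ((L * H₁' - S * B') * I + L * B'ᵀ * S)))
      = c • (((-((L * H₁ - S * B) * Γ - L * Bᵀ * L) * H₁' + L * (0 : Matrix ν ν ℝ)
              - (((L * H₁ - S * B) * I + L * Bᵀ * S) * B' + S * (0 : Matrix π ν ℝ))) * I
            + (L * H₁ - S * B) * (-((Γ * H₁' + I * B') * I + Γ * B'ᵀ * S)))
          - ((-((L * H₁ - S * B) * Γ - L * Bᵀ * L) * (-B'ᵀ) + L * (0 : Matrix π ν ℝ)ᵀ) * S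
              + L * (-Bᵀ) * ((L * H₁' - S * B') * I + L * B'ᵀ * S))) := by
  simp only [Matrix.mul_zero, transpose_zero, add_zero, Matrix.mul_add, Matrix.add_mul, Matrix.sub_mul, Matrix.mul_sub,
    Matrix.neg_mul, Matrix.mul_neg, Matrix.mul_smul, Matrix.smul_mul, transpose_smul, smul_add, smul_sub, smul_neg]

/-- [folklore] The bilinear part is ADDITIVE in the RIGHT pair `(H₁′, B′)`. -/
theorem orderTwo_bil_add_right (H₁ H₁' K₁' : Matrix ν ν ℝ) (B B' C' : Matrix π ν ℝ) :
    (((-((L * H₁ - S * B) * Γ - L * Bᵀ * L) * (H₁' + K₁') + L * (0 : Matrix ν ν ℝ)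
          - (((L * H₁ - S * B) * I + L * Bᵀ * S) * (B' + C') + S * (0 : Matrix π ν ℝ))) * I
        + (L * H₁ - S * B) * (-((Γ * (H₁' + K₁') + I * (B' + C')) * I + Γ * (B' + C')ᵀ * S)))
      - ((-((L * H₁ - S * B) * Γ - L * Bᵀ * L) * (-(B' + C')ᵀ) + L * (0 : Matrix π ν ℝ)ᵀ) * S
          + L * (-Bᵀ) * ((L * (H₁' + K₁') - S * (B' + C')) * I + L * (B' + C')ᵀ * S)))
      = (((-((L * H₁ - S * B) * Γ - L * Bᵀ * L) * H₁' + L * (0 : Matrix ν ν ℝ)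
            - (((L * H₁ - S * B) * I + L * Bᵀ * S) * B' + S * (0 : Matrix π ν ℝ))) * I
          + (L * H₁ - S * B) * (-((Γ * H₁' + I * B') * I + Γ * B'ᵀ * S)))
        - ((-((L * H₁ - S * B) * Γ - L * Bᵀ * L) * (-B'ᵀ) + L * (0 : Matrix π ν ℝ)ᵀ) * S
            + L * (-Bᵀ) * ((L * H₁' - S * B') * I + L * B'ᵀ * S)))
        + (((-((L * H₁ - S * B) * Γ - L * Bᵀ * L) * K₁' + L * (0 : Matrix ν ν ℝ)
              - (((L * H₁ - S * B) * I + L * Bᵀ * S) * C' + S * (0 : Matrix π ν ℝ))) * I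
            + (L * H₁ - S * B) * (-((Γ * K₁' + I * C') * I + Γ * C'ᵀ * S)))
          - ((-((L * H₁ - S * B) * Γ - L * Bᵀ * L) * (-C'ᵀ) + L * (0 : Matrix π ν ℝ)ᵀ) * S
              + L * (-Bᵀ) * ((L * K₁' - S * C') * I + L * C'ᵀ * S))) := by
  simp only [Matrix.mul_zero, transpose_zero, add_zero, Matrix.mul_add, Matrix.add_mul, Matrix.sub_mul, Matrix.mul_sub,
    Matrix.neg_mul, Matrix.mul_neg, transpose_add, neg_add]
  abel

/-- [folklore] The bilinear part is HOMOGENEOUS in the RIGHT pair `(H₁′, B′)`. -/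
theorem orderTwo_bil_smul_right (c : ℝ) (H₁ H₁' : Matrix ν ν ℝ) (B B' : Matrix π ν ℝ) :
    (((-((L * H₁ - S * B) * Γ - L * Bᵀ * L) * (c • H₁') + L * (0 : Matrix ν ν ℝ)
          - (((L * H₁ - S * B) * I + L * Bᵀ * S) * (c • B') + S * (0 : Matrix π ν ℝ))) * I
        + (L * H₁ - S * B) * (-((Γ * (c • H₁') + I * (c • B')) * I + Γ * (c • B')ᵀ * S)))
      - ((-((L * H₁ - S * B) * Γ - L * Bᵀ * L) * (-(c • B')ᵀ) + L * (0 : Matrix π ν ℝ)ᵀ) * S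
          + L * (-Bᵀ) * ((L * (c • H₁') - S * (c • B')) * I + L * (c • B')ᵀ * S)))
      = c • (((-((L * H₁ - S * B) * Γ - L * Bᵀ * L) * H₁' + L * (0 : Matrix ν ν ℝ)
              - (((L * H₁ - S * B) * I + L * Bᵀ * S) * B' + S * (0 : Matrix π ν ℝ))) * I
            + (L * H₁ - S * B) * (-((Γ * H₁' + I * B') * I + Γ * B'ᵀ * S)))
          - ((-((L * H₁ - S * B) * Γ - L * Bᵀ * L) * (-B'ᵀ) + L * (0 : Matrix π ν ℝ)ᵀ) * S
              + L * (-Bᵀ) * ((L * H₁' - S * B') * I + L * B'ᵀ * S))) := by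
  simp only [Matrix.mul_zero, transpose_zero, add_zero, Matrix.mul_add, Matrix.add_mul, Matrix.sub_mul, Matrix.mul_sub,
    Matrix.neg_mul, Matrix.mul_neg, Matrix.mul_smul, Matrix.smul_mul, transpose_smul, smul_add, smul_sub, smul_neg]

/-- [folklore] The linear part `(L·H₂ − S·B_q)·I − L·B_qᵀ·S` is ADDITIVE in `(H₂, B_q)`. -/
theorem orderTwo_lin_add (H₂ H₂' : Matrix ν ν ℝ) (Bq Bq' : Matrix π ν ℝ) :
    (L * (H₂ + H₂') - S * (Bq + Bq')) * I - L * (Bq + Bq')ᵀ * S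
      = ((L * H₂ - S * Bq) * I - L * Bqᵀ * S) + ((L * H₂' - S * Bq') * I - L * Bq'ᵀ * S) := by
  simp only [Matrix.mul_add, Matrix.add_mul, Matrix.sub_mul, transpose_add]
  abel

/-- [folklore] The linear part is HOMOGENEOUS in `(H₂, B_q)`. -/
theorem orderTwo_lin_smul (c : ℝ) (H₂ : Matrix ν ν ℝ) (Bq : Matrix π ν ℝ) :
    (L * (c • H₂) - S * (c • Bq)) * I - L * (c • Bq)ᵀ * S = c • ((L * H₂ - S * Bq) * I - L * Bqᵀ * S) := by
  simp only [Matrix.mul_smul, Matrix.smul_mul, Matrix.sub_mul, transpose_smul, smul_sub]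

/-- [folklore] **THE LINEAR PART PACKS** over a double family: `(L·(ΣΣ rr•H₂) − S·(ΣΣ rr•B_q))·I − L·(ΣΣ rr•B_q)ᵀ·S = ΣΣ (r_k·r_l) • ((L·H₂ᵏˡ − S·B_qᵏˡ)·I − L·(B_qᵏˡ)ᵀ·S)`. -/
theorem orderTwo_lin_sum_sum_smul (r : σ → ℝ) (H₂ : σ → σ → Matrix ν ν ℝ) (Bq : σ → σ → Matrix π ν ℝ) :
    ((L * (∑ k, ∑ l, (r k * r l) • H₂ k l) - S * (∑ k, ∑ l, (r k * r l) • Bq k l)) * I - L * (∑ k, ∑ l, (r k * r l) • Bq k l)ᵀ * S)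
      = ∑ k, ∑ l, (r k * r l) • ((L * H₂ k l - S * Bq k l) * I - L * (Bq k l)ᵀ * S) := by
  simp only [Matrix.mul_sum, Matrix.sum_mul, Matrix.mul_smul, Matrix.smul_mul, Matrix.sub_mul, transpose_sum, transpose_smul, smul_sub,
    Finset.sum_sub_distrib]

/-- [folklore] **THE ORDER-2 DRESSED WORD PACKS (POLARISED).**  Along packed first jets `H₁ = Σ_k r_k • H₁ᵏ`, `B = Σ_k r_k • Bᵏ` (read in BOTH slots) and
packed second jets `H₂ = Σ_{k,l} (r_k·r_l) • H₂ᵏˡ`, `B_q = Σ_{k,l} (r_k·r_l) • B_qᵏˡ`, the word is the `(r_k·r_l)`-superposition of the polarised word on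
the per-direction tables: `W₂♭(H₁, B | H₁, B | H₂, B_q) = Σ_k Σ_l (r_k·r_l) • W₂♭(H₁ᵏ, Bᵏ | H₁ˡ, Bˡ | H₂ᵏˡ, B_qᵏˡ)`.  The left-hand side IS the door's
order-2 word (p323821; VERBATIM in U20∕U21∕U22∕#21) at the packed jets. -/
theorem orderTwo_word_sum_sum_smul (r : σ → ℝ) (H₁ : σ → Matrix ν ν ℝ) (B : σ → Matrix π ν ℝ)
    (H₂ : σ → σ → Matrix ν ν ℝ) (Bq : σ → σ → Matrix π ν ℝ) :
    (((-((L * (∑ k, r k • H₁ k) - S * (∑ k, r k • B k)) * Γ - L * (∑ k, r k • B k)ᵀ * L) * (∑ k, r k • H₁ k) + L * (∑ k, ∑ l, (r k * r l) • H₂ k l)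
          - (((L * (∑ k, r k • H₁ k) - S * (∑ k, r k • B k)) * I + L * (∑ k, r k • B k)ᵀ * S) * (∑ k, r k • B k) + S * (∑ k, ∑ l, (r k * r l) • Bq k l))) * I
        + (L * (∑ k, r k • H₁ k) - S * (∑ k, r k • B k)) * (-((Γ * (∑ k, r k • H₁ k) + I * (∑ k, r k • B k)) * I + Γ * (∑ k, r k • B k)ᵀ * S)))
      - ((-((L * (∑ k, r k • H₁ k) - S * (∑ k, r k • B k)) * Γ - L * (∑ k, r k • B k)ᵀ * L) * (-(∑ k, r k • B k)ᵀ) + L * (∑ k, ∑ l, (r k * r l) • Bq k l)ᵀ) * S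
          + L * (-(∑ k, r k • B k)ᵀ) * ((L * (∑ k, r k • H₁ k) - S * (∑ k, r k • B k)) * I + L * (∑ k, r k • B k)ᵀ * S)))
      = ∑ k, ∑ l, (r k * r l) •
          (((-((L * H₁ k - S * B k) * Γ - L * (B k)ᵀ * L) * H₁ l + L * H₂ k l
              - (((L * H₁ k - S * B k) * I + L * (B k)ᵀ * S) * B l + S * Bq k l)) * I
            + (L * H₁ k - S * B k) * (-((Γ * H₁ l + I * B l) * I + Γ * (B l)ᵀ * S)))
          - ((-((L * H₁ k - S * B k) * Γ - L * (B k)ᵀ * L) * (-(B l)ᵀ) + L * (Bq k l)ᵀ) * S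
              + L * (-(B k)ᵀ) * ((L * H₁ l - S * B l) * I + L * (B l)ᵀ * S))) := by
  -- split off the linear part, pack the bilinear part over the two pair-slots and the linear part over the double family, re-assemble per `(k, l)`
  rw [orderTwo_word_split Γ I L S,
    pack_pair₂_of_add_smul
      (fun X Y X' Y' =>
        (((-((L * X - S * Y) * Γ - L * Yᵀ * L) * X' + L * (0 : Matrix ν ν ℝ)
            - (((L * X - S * Y) * I + L * Yᵀ * S) * Y' + S * (0 : Matrix π ν ℝ))) * I
          + (L * X - S * Y) * (-((Γ * X' + I * Y') * I + Γ * Y'ᵀ * S)))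
        - ((-((L * X - S * Y) * Γ - L * Yᵀ * L) * (-Y'ᵀ) + L * (0 : Matrix π ν ℝ)ᵀ) * S
            + L * (-Yᵀ) * ((L * X' - S * Y') * I + L * Y'ᵀ * S))))
      (fun a₁ a₁' a₂ a₂' b₁ b₂ => orderTwo_bil_add_left Γ I L S a₁ a₁' b₁ a₂ a₂' b₂)
      (fun c a₁ a₂ b₁ b₂ => orderTwo_bil_smul_left Γ I L S c a₁ b₁ a₂ b₂)
      (fun a₁ a₂ b₁ b₁' b₂ b₂' => orderTwo_bil_add_right Γ I L S a₁ b₁ b₁' a₂ b₂ b₂')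
      (fun c a₁ a₂ b₁ b₂ => orderTwo_bil_smul_right Γ I L S c a₁ b₁ a₂ b₂) r H₁ B H₁ B,
    orderTwo_lin_sum_sum_smul I L S, ← Finset.sum_add_distrib]
  refine Finset.sum_congr rfl fun k _ => ?_
  rw [← Finset.sum_add_distrib]
  refine Finset.sum_congr rfl fun l _ => ?_
  rw [← smul_add, ← orderTwo_word_split Γ I L S]

end OrderTwo

/-! ## §4 In #20 §5's currency: the `μμ` blocks of the packed words -/

section Currency

variable {ν μ ρ σ : Type*} [Fintype ν] [Fintype μ] [Fintype ρ] [Fintype σ]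
variable (Γ : Matrix ν ν ℝ) (I : Matrix ν (μ ⊕ ρ) ℝ) (L : Matrix (μ ⊕ ρ) ν ℝ) (S : Matrix (μ ⊕ ρ) (μ ⊕ ρ) ℝ)

/-- [folklore] **THE COARSE FIRST JET PACKS** (`G₁ k` of #20 §5): the `μμ` block of the order-1 word at packed fine jets is
`Σ_k r_k • ((L·H₁ᵏ − S·Bᵏ)·I + L·(Bᵏ)ᵀ·S).toBlocks₁₁`. -/
theorem orderOne_word_toBlocks₁₁_sum_smul (r : σ → ℝ) (H₁ : σ → Matrix ν ν ℝ) (B : σ → Matrix (μ ⊕ ρ) ν ℝ) :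
    ((L * (∑ k, r k • H₁ k) - S * (∑ k, r k • B k)) * I + L * (∑ k, r k • B k)ᵀ * S).toBlocks₁₁
      = ∑ k, r k • ((L * H₁ k - S * B k) * I + L * (B k)ᵀ * S).toBlocks₁₁ := by
  rw [orderOne_word_sum_smul I L S, toBlocks₁₁_sum_smul]

/-- [folklore] **THE COARSE SECOND JET PACKS** (`G₂ k l` of #20 §5, before symmetrisation by `SecondVarKernelLaw.sum_sum_smul_symmetrise`): the `μμ` block of
the order-2 word at packed jets is `Σ_k Σ_l (r_k·r_l) • (W₂♭(H₁ᵏ, Bᵏ | H₁ˡ, Bˡ | H₂ᵏˡ, B_qᵏˡ)).toBlocks₁₁`. -/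
theorem orderTwo_word_toBlocks₁₁_sum_sum_smul (r : σ → ℝ) (H₁ : σ → Matrix ν ν ℝ) (B : σ → Matrix (μ ⊕ ρ) ν ℝ)
    (H₂ : σ → σ → Matrix ν ν ℝ) (Bq : σ → σ → Matrix (μ ⊕ ρ) ν ℝ) :
    (((-((L * (∑ k, r k • H₁ k) - S * (∑ k, r k • B k)) * Γ - L * (∑ k, r k • B k)ᵀ * L) * (∑ k, r k • H₁ k) + L * (∑ k, ∑ l, (r k * r l) • H₂ k l)
          - (((L * (∑ k, r k • H₁ k) - S * (∑ k, r k • B k)) * I + L * (∑ k, r k • B k)ᵀ * S) * (∑ k, r k • B k) + S * (∑ k, ∑ l, (r k * r l) • Bq k l))) * I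
        + (L * (∑ k, r k • H₁ k) - S * (∑ k, r k • B k)) * (-((Γ * (∑ k, r k • H₁ k) + I * (∑ k, r k • B k)) * I + Γ * (∑ k, r k • B k)ᵀ * S)))
      - ((-((L * (∑ k, r k • H₁ k) - S * (∑ k, r k • B k)) * Γ - L * (∑ k, r k • B k)ᵀ * L) * (-(∑ k, r k • B k)ᵀ) + L * (∑ k, ∑ l, (r k * r l) • Bq k l)ᵀ) * S
          + L * (-(∑ k, r k • B k)ᵀ) * ((L * (∑ k, r k • H₁ k) - S * (∑ k, r k • B k)) * I + L * (∑ k, r k • B k)ᵀ * S))).toBlocks₁₁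
      = ∑ k, ∑ l, (r k * r l) •
          (((-((L * H₁ k - S * B k) * Γ - L * (B k)ᵀ * L) * H₁ l + L * H₂ k l
              - (((L * H₁ k - S * B k) * I + L * (B k)ᵀ * S) * B l + S * Bq k l)) * I
            + (L * H₁ k - S * B k) * (-((Γ * H₁ l + I * B l) * I + Γ * (B l)ᵀ * S)))
          - ((-((L * H₁ k - S * B k) * Γ - L * (B k)ᵀ * L) * (-(B l)ᵀ) + L * (Bq k l)ᵀ) * S
              + L * (-(B k)ᵀ) * ((L * H₁ l - S * B l) * I + L * (B l)ᵀ * S))).toBlocks₁₁ := by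
  rw [orderTwo_word_sum_sum_smul Γ I L S, toBlocks₁₁_sum_sum_smul]

end Currency

/-! ## §5 The one-shot system's bilinear word: products and the commutator `L(h)·E_λ − E_λ·L(h)` pack -/

section Products

variable {ν π σ : Type*} [Fintype σ]

/-- [folklore] **PRODUCTS OF PACKED FAMILIES PACK**: `(Σ_k r_k • X k)·(Σ_l r′_l • Y l) = Σ_k Σ_l (r_k·r′_l) • (X k·Y l)`. -/
theorem sum_smul_mul_sum_smul [Fintype ν] {ξ : Type*} (r r' : σ → ℝ) (X : σ → Matrix π ν ℝ) (Y : σ → Matrix ν ξ ℝ) :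
    (∑ k, r k • X k) * (∑ l, r' l • Y l) = ∑ k, ∑ l, (r k * r' l) • (X k * Y l) := by
  rw [Matrix.sum_mul]
  refine Finset.sum_congr rfl fun k _ => ?_
  rw [Matrix.smul_mul, Matrix.mul_sum, Finset.smul_sum]
  refine Finset.sum_congr rfl fun l _ => ?_
  rw [Matrix.mul_smul, smul_smul]

/-- [folklore] **THE COMMUTATOR WORD PACKS** (U20∕U21's `hH′₂` summand `w • (L(h)·E_λ − E_λ·L(h))` with `L(h) = Σ_k r_k • L(h_k)`, `E_λ = Σ_l r_l • E_(λ_l)`):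
`(Σ r•X)·(Σ r•Y) − (Σ r•Y)·(Σ r•X) = Σ_k Σ_l (r_k·r_l) • (X k·Y l − Y k·X l)` — a `(k,l)`-family the consumer symmetrises with #20 `sum_sum_smul_symmetrise`. -/
theorem commutator_sum_smul [Fintype ν] (r : σ → ℝ) (X Y : σ → Matrix ν ν ℝ) :
    (∑ k, r k • X k) * (∑ l, r l • Y l) - (∑ l, r l • Y l) * (∑ k, r k • X k) = ∑ k, ∑ l, (r k * r l) • (X k * Y l - Y k * X l) := by
  rw [sum_smul_mul_sum_smul, sum_smul_mul_sum_smul]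
  simp only [smul_sub, Finset.sum_sub_distrib]

/-- [folklore] **THE GAUGE GENERATOR PACKS**: `diagonal (fun i => Σ_k r_k·d k i) = Σ_k r_k • diagonal (d k)` (U20∕U21's `E_λ = diagonal (λ ∘ pr₁)` along
`λ = Σ_k r_k • λ_k`). -/
theorem diagonal_sum_smul [DecidableEq ν] (r : σ → ℝ) (d : σ → ν → ℝ) :
    Matrix.diagonal (fun i => ∑ k, r k * d k i) = ∑ k, r k • Matrix.diagonal (d k) := by
  ext i j
  by_cases h : i = j
  · subst h; simp [Matrix.sum_apply]
  · simp [Matrix.sum_apply, h]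

end Products

end Summit.QuantumFields.BalabanUV.Beta.FP.DressedWordsPacked

end
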